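import Literature.Barriers.ValiantsHypothesis.BIJL18BorderCompletionRankProofs
import Literature.Computability.Complexity.MaxTwoSat
import Literature.Computability.Complexity.CodeFPListKit
import Literature.Computability.Complexity.CodeFPBudgets
import HarnessLib

/-!
# Bläser–Ikenmeyer–Jindal–Lysikov 2018, §3 — discharge of the NP-hardness of completion rank
(Lemma 11, second sentence) and of border completion rank (Thm. 3)

Sibling proof file of `BIJL18MatrixCompletion.lean` (val-lit t23). Proves the two named facts
`BIJL2018_lemma11_npHard K : IsNPHard (crLanguage K)` ("Thus the problem `CR(A₀, A₁, …, A_t) ≤? k`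
is NP-hard", ECCC p. 9) and `BIJL2018_thm3 K : IsNPHard (borderCRLanguage K)` ("Given a tensor `t`
over `K` and an integer `r`, deciding whether the border completion rank `\underline{CR}(t) ≤ r` is
NP-hard", ECCC p. 6; proof p. 10: "Lemma 14 and the NP-hardness of Max-2-SAT") for EVERY field `K`,
exactly along the printed route: ONE polynomial-time Karp map sends a Max-2-SAT instance `(φ, b)`
(`MAX2SAT`, NP-hard by `MAX2SAT_isNPHard`, Garey–Johnson–Stockmeyer 1976, tree file
`MaxTwoSat.lean`) to the Boolean code of the §3 tensor `(A₀, A₁, …, A_t)` of `φ` with the bound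
`r = 2s − b`; its correctness is Lemma 11 (`BIJL2018_lemma11_holds`) for completion rank and
Lemma 14 (`BIJL2018_lemma14_holds`) for border completion rank.

* Renaming (`BIJL18NPHard.vlist`, `rhoN`, `rho`, `pairsFin`): the occurring variables of `φ`
  (clauses = pairs of literal occurrences) are renamed injectively into `Fin (2s+1)` by their first
  occurrence, so that the §3 tensor `bijlA₀ K (pairsFin φ)`, `bijlSlices K (pairsFin φ)` has
  `t = 2s + 1` slices of `2s × 2s` matrices — polynomial in the instance (variable NAMES are binary
  numerals and may be exponentially large); the Max-2-SAT objective is preserved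
  (`numSat₂_pairsFin`, `exists_numSat₂_pairsFin_iff`).
* The integer entries (`a0Int`, `sliceInt`, `entryInt`, `entries`, row-major `(h, i, j) ↦
  h n² + i n + j`, `n = 2s`) realise exactly the reindexed §3 tensor (`slice₀OfList_entries`,
  `slicesOfList_entries`, along `finProdFinEquiv : Fin s × Fin 2 ≃ Fin (2s)`), and completion rank /
  border completion rank are invariant under reindexing (`completionRank_reindex`,
  `borderCompletionRank_reindex`).
* `BIJL18NPHard.reduceT` (the instance map, guard "2-CNF and `b ≤ 2s`", fixed ill-formed
  non-member otherwise), `encode_reduceT_mem_crLanguage_iff`, `encode_reduceT_mem_borderCRLanguage_iff`;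
  the machine `BIJL18NPHard.reduceTFP` in the typed `CodeFP` algebra (`CodeFP.lean`), the string
  guard `BIJL18NPHard.isCanonInstFn` (canonical-code test for `encodingCNF.pairBool encodingNatBool`,
  `CanonicalCodes.lean`), `MAX2SAT_karpReducible_crLanguage`, `MAX2SAT_karpReducible_borderCRLanguage`;
* **`BIJL2018_lemma11_npHard_holds`**, **`BIJL2018_thm3_holds`**.

Theorem-only file (its `def`s are proof plumbing: the instance map and its integer tables; no
statement of `BIJL18MatrixCompletion.lean` is touched, no new fact). HONEST FRAMING: typed
literature; `VP ≠ VNP` is NOT proved and nothing here is progress on it.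

## References

* [BlaserIkenmeyerJindalLysikov2018] M. Bläser, C. Ikenmeyer, G. Jindal, V. Lysikov, *Generalized
  matrix completion and algebraic natural proofs*, STOC 2018 / ECCC TR18-064, Lemma 11 (ECCC p. 9),
  Thm. 3 (p. 6, proof p. 10), §1.4 (the decision problems).
* [GareyJohnsonStockmeyer1976] M. R. Garey, D. S. Johnson, L. Stockmeyer, *Some simplified
  NP-complete graph problems*, Theoret. Comput. Sci. 1 (1976), Thm. 1.1 (Max Sat2 is NP-complete).
* [AroraBarak2009] S. Arora, B. Barak, *Computational Complexity: A Modern Approach*, CUP 2009,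
  Def. 2.7 / Thm. 2.8 (Karp reductions, hardness propagates), §1.3, §0.1.
-/

noncomputable section

namespace Literature.Barriers.ValiantsHypothesis

open Literature.Computability.AlgebraicComplexity Literature.Computability.Complexity
open _root_.Computability
open scoped Literature.Computability.Complexity.Notation

universe u

/-! ### Completion rank and border completion rank are invariant under reindexing -/

section Reindex

variable {K : Type u} [Field K] {ι ι' : Type*} [Fintype ι] [Fintype ι'] {κ κ' : Type*} [Fintype κ] [Fintype κ']

omit [Fintype ι] [Fintype ι'] in
/-- The pencil of the reindexed tensor is the reindexed pencil (slices re-listed along `g`, the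
coefficients along `g⁻¹`). [cite: BlaserIkenmeyerJindalLysikov2018, Def. 8] -/
theorem pencilEval_reindex {L : Type*} [Field L] (e : ι ≃ ι') (g : κ' ≃ κ) (A₀ : Matrix ι ι L)
    (A : κ → Matrix ι ι L) (c : κ' → L) :
    pencilEval (A₀.reindex e e) (fun k' => (A (g k')).reindex e e) c =
      (pencilEval A₀ A (c ∘ g.symm)).reindex e e := by
  ext i j
  simp only [pencilEval, Matrix.reindex_apply, Matrix.add_apply, Matrix.submatrix_apply,
    Matrix.sum_apply, Matrix.smul_apply, smul_eq_mul, Function.comp_apply]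
  congr 1
  rw [← g.sum_comp]
  simp only [Equiv.symm_apply_apply]

/-- **Completion rank is invariant under reindexing** rows/columns and slices.
[cite: BlaserIkenmeyerJindalLysikov2018, Def. 8] -/
theorem completionRank_reindex (e : ι ≃ ι') (g : κ' ≃ κ) (A₀ : Matrix ι ι K) (A : κ → Matrix ι ι K) :
    completionRank (A₀.reindex e e) (fun k' => (A (g k')).reindex e e) = completionRank A₀ A := by
  unfold completionRank
  congr 1
  ext r
  constructor
  · rintro ⟨c, hc⟩
    exact ⟨c ∘ g.symm, by rwa [pencilEval_reindex, Matrix.rank_reindex] at hc⟩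
  · rintro ⟨c, hc⟩
    refine ⟨c ∘ g, ?_⟩
    rw [pencilEval_reindex, Matrix.rank_reindex]
    have : (c ∘ ⇑g) ∘ ⇑g.symm = c := by ext k; simp
    rwa [this]

omit [Fintype ι] [Fintype ι'] in
/-- Entrywise approximation is invariant under reindexing. [cite: BlaserIkenmeyerJindalLysikov2018, Def. 9] -/
theorem IsMatrixApproxOf.reindex {A : Matrix ι ι K} {B : Matrix ι ι (RatFunc K)} (h : IsMatrixApproxOf A B)
    (e : ι ≃ ι') : IsMatrixApproxOf (A.reindex e e) (B.reindex e e) :=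
  fun i j => h (e.symm i) (e.symm j)

/-- A border witness of a tensor yields one of the reindexed tensor.
[cite: BlaserIkenmeyerJindalLysikov2018, Def. 9] -/
theorem IsBorderWitness.reindex (e : ι ≃ ι') (g : κ' ≃ κ) {A₀ : Matrix ι ι K} {A : κ → Matrix ι ι K} {r : ℕ}
    {B₀ : Matrix ι ι (RatFunc K)} {B : κ → Matrix ι ι (RatFunc K)} {c : κ → RatFunc K}
    (h : IsBorderWitness A₀ A r B₀ B c) :
    IsBorderWitness (A₀.reindex e e) (fun k' => (A (g k')).reindex e e) r (B₀.reindex e e)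
      (fun k' => (B (g k')).reindex e e) (c ∘ g) := by
  obtain ⟨h0, h1, h2, h3, h4⟩ := h
  refine ⟨h0.reindex e, fun k' => (h1 (g k')).reindex e, by rwa [Matrix.rank_reindex, Matrix.rank_reindex],
    fun k' => by rw [Matrix.rank_reindex, Matrix.rank_reindex]; exact h3 (g k'), ?_⟩
  rw [pencilEval_reindex, Matrix.rank_reindex]
  have : (c ∘ ⇑g) ∘ ⇑g.symm = c := by ext k; simp
  rwa [this]

/-- **Border completion rank is invariant under reindexing** rows/columns and slices.
[cite: BlaserIkenmeyerJindalLysikov2018, Def. 9] -/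
theorem borderCompletionRank_reindex (e : ι ≃ ι') (g : κ' ≃ κ) (A₀ : Matrix ι ι K) (A : κ → Matrix ι ι K) :
    borderCompletionRank (A₀.reindex e e) (fun k' => (A (g k')).reindex e e) = borderCompletionRank A₀ A := by
  unfold borderCompletionRank
  congr 1
  ext r
  constructor
  · rintro ⟨B₀, B, c, h⟩
    have h' := h.reindex e.symm g.symm
    have hA0 : (A₀.reindex e e).reindex e.symm e.symm = A₀ := by ext i j; simp
    have hA : (fun k => ((fun k' => (A (g k')).reindex e e) (g.symm k)).reindex e.symm e.symm) = A := by
      funext k; ext i j; simp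
    rw [hA0, hA] at h'
    exact ⟨_, _, _, h'⟩
  · rintro ⟨B₀, B, c, h⟩
    exact ⟨_, _, _, h.reindex e g⟩

end Reindex

/-! ### The Karp map: renaming the variables, the integer tables, the instance -/

namespace BIJL18NPHard

open CNF MaxTwoSat

variable (φ : CNF ℕ)

/-- The variable occurrences of `φ`, in order (length `2s` for a 2-CNF). [cite: BlaserIkenmeyerJindalLysikov2018, Lemma 11 (proof)] -/
def vlist : List ℕ := φ.flatten.map Prod.fst

/-- The number of slices `t = 2s + 1` (an injective renaming of the occurring variables into
`Fin (2s+1)` by first occurrence; index `2s` is a spare). [cite: BlaserIkenmeyerJindalLysikov2018, Lemma 11 (proof)] -/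
def tOf : ℕ := 2 * φ.length + 1

/-- The side length `n = 2s` of the matrices. [cite: BlaserIkenmeyerJindalLysikov2018, Lemma 11 (proof)] -/
def nOf : ℕ := φ.length * 2

/-- The renamed variable (as a number `< t`): position of its first occurrence, capped at `2s`.
[cite: BlaserIkenmeyerJindalLysikov2018, Lemma 11 (proof)] -/
def rhoN (v : ℕ) : ℕ := min ((vlist φ).idxOf v) (2 * φ.length)

/-- The renamed variable in `Fin t`. [cite: BlaserIkenmeyerJindalLysikov2018, Lemma 11 (proof)] -/
def rho (v : ℕ) : Fin (tOf φ) := ⟨rhoN φ v, by unfold rhoN tOf; omega⟩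

/-- The renamed literal. [cite: BlaserIkenmeyerJindalLysikov2018, Lemma 11 (proof)] -/
def litFin (l : Literal ℕ) : Literal (Fin (tOf φ)) := (rho φ l.1, l.2)

/-- Literal occurrence `a ∈ {0,1}` of clause `i` (junk `x̄₀` out of range). [cite: BlaserIkenmeyerJindalLysikov2018, Lemma 11 ("Let ℓ_{i,1} and ℓ_{i,2} be the literals of cᵢ")] -/
def litAt (i a : ℕ) : Literal ℕ := (φ.getD i []).getD a (0, false)

/-- **The renamed 2-CNF as a list of literal pairs over `Fin t`** (the input format of the typed
Lemma 11 / Lemma 14). [cite: BlaserIkenmeyerJindalLysikov2018, Lemma 11] -/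
def pairsFin : List (Literal (Fin (tOf φ)) × Literal (Fin (tOf φ))) :=
  φ.map fun c => (litFin φ (c.getD 0 (0, false)), litFin φ (c.getD 1 (0, false)))

/-- `pairsFin` has one pair per clause. [cite: BlaserIkenmeyerJindalLysikov2018, Lemma 11] -/
@[simp] theorem length_pairsFin : (pairsFin φ).length = φ.length := by simp [pairsFin]

/-- An occurring variable is recovered from its renamed index. [cite: BlaserIkenmeyerJindalLysikov2018, Lemma 11 (proof)] -/
theorem getD_vlist_rhoN (h2 : IsWidthEq 2 φ) {c : Clause ℕ} (hc : c ∈ φ) {l : Literal ℕ} (hl : l ∈ c) :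
    (vlist φ).getD (rhoN φ l.1) 0 = l.1 := by
  have hmem : l.1 ∈ vlist φ := List.mem_map.2 ⟨l, List.mem_flatten.2 ⟨c, hc, hl⟩, rfl⟩
  have hlen : (vlist φ).length = 2 * φ.length := by
    have key : ∀ ψ : CNF ℕ, IsWidthEq 2 ψ → (vlist ψ).length = 2 * ψ.length := by
      intro ψ hψ
      induction ψ with
      | nil => rfl
      | cons d ψ ih =>
        rw [vlist, List.flatten_cons, List.map_append, List.length_append, ← vlist,
          ih fun d' hd' => hψ d' (List.mem_cons_of_mem _ hd'), List.length_map, hψ d List.mem_cons_self,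
          List.length_cons]
        ring
    exact key φ h2
  have hlt : (vlist φ).idxOf l.1 < (vlist φ).length := List.idxOf_lt_length_of_mem hmem
  rw [rhoN, min_eq_left (by omega), List.getD_eq_getElem _ _ hlt, List.getElem_idxOf hlt]

/-- **The Max-2-SAT objective is preserved by the renaming** (from an assignment of the renamed
variables). [cite: BlaserIkenmeyerJindalLysikov2018, Lemma 11] -/
theorem numSat₂_pairsFin (h2 : IsWidthEq 2 φ) (τ : Fin (tOf φ) → Bool) :
    numSat₂ (pairsFin φ) τ = φ.numSatClauses (fun v => τ (rho φ v)) := by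
  rw [numSat₂, pairsFin, List.countP_map, numSatClauses]
  refine List.countP_congr fun c hc => ?_
  obtain ⟨l₁, l₂, rfl⟩ : ∃ l₁ l₂, c = [l₁, l₂] := by
    have h := h2 c hc
    match c, h with
    | [l₁, l₂], _ => exact ⟨l₁, l₂, rfl⟩
  simp [Clause.eval, Literal.eval, litFin]

/-- **The Max-2-SAT objective is preserved by the renaming** (existential form).
[cite: BlaserIkenmeyerJindalLysikov2018, Lemma 11] -/
theorem exists_numSat₂_pairsFin_iff (h2 : IsWidthEq 2 φ) (b : ℕ) :
    (∃ τ : Fin (tOf φ) → Bool, b ≤ numSat₂ (pairsFin φ) τ) ↔ ∃ σ : ℕ → Bool, b ≤ φ.numSatClauses σ := by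
  constructor
  · rintro ⟨τ, hτ⟩
    exact ⟨_, by rwa [numSat₂_pairsFin φ h2] at hτ⟩
  · rintro ⟨σ, hσ⟩
    refine ⟨fun j => σ ((vlist φ).getD j.1 0), ?_⟩
    rw [numSat₂_pairsFin φ h2]
    convert hσ using 1
    unfold numSatClauses
    refine List.countP_congr fun c hc => ?_
    have key : ∀ l ∈ c, Literal.eval (fun v => σ ((vlist φ).getD (rho φ v).1 0)) l = Literal.eval σ l := by
      intro l hl
      simp only [Literal.eval, rho, getD_vlist_rhoN φ h2 hc hl]
    rw [Clause.eval, Clause.eval, List.any_eq_true, List.any_eq_true]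
    exact ⟨fun ⟨l, hl, h⟩ => ⟨l, hl, by rwa [key l hl] at h⟩, fun ⟨l, hl, h⟩ => ⟨l, hl, by rwa [key l hl]⟩⟩

/-- **The constant slice as an integer table** on `ℕ × ℕ` (row `i = 2·clause + slot`).
[cite: BlaserIkenmeyerJindalLysikov2018, §3 (construction before Obs. 10)] -/
def a0Int (i j : ℕ) : ℤ :=
  if i / 2 = j / 2 then
    (if i % 2 = j % 2 then (if (litAt φ (i / 2) (i % 2)).2 then 1 else 0) else if i % 2 = 0 then 1 else 0)
  else 0

/-- **The slice `A_{k+1}` as an integer table.** [cite: BlaserIkenmeyerJindalLysikov2018, §3 (construction before Obs. 10)] -/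
def sliceInt (k i j : ℕ) : ℤ :=
  if i = j then
    (if rhoN φ (litAt φ (i / 2) (i % 2)).1 = k then (if (litAt φ (i / 2) (i % 2)).2 then -1 else 1) else 0)
  else 0

/-- Entry `(h, i, j)` of the tensor (`h = 0` the constant slice). [cite: BlaserIkenmeyerJindalLysikov2018, §1.4] -/
def entryInt (h i j : ℕ) : ℤ :=
  if h = 0 then a0Int φ i j else sliceInt φ (h - 1) i j

/-- **The row-major entry list** `(t+1) n²` long. [cite: BlaserIkenmeyerJindalLysikov2018, §1.4] -/
def entries : List ℤ :=
  (List.range ((tOf φ + 1) * (nOf φ * nOf φ))).map fun N =>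
    entryInt φ (N / (nOf φ * nOf φ)) (N / nOf φ % nOf φ) (N % nOf φ)

/-- The instance `(n, t, entries, 2s − b)`. [cite: BlaserIkenmeyerJindalLysikov2018, Lemma 11] -/
def instOf (b : ℕ) : ℕ × ℕ × List ℤ × ℕ := (nOf φ, tOf φ, entries φ, 2 * φ.length - b)

/-- A fixed ill-formed instance (entry list of the wrong length): in neither language.
[cite: BlaserIkenmeyerJindalLysikov2018, §1.4] -/
def badInst : ℕ × ℕ × List ℤ × ℕ := (1, 0, [], 0)

/-- **The instance map** `(φ, b) ↦ (n, t, entries, 2s − b)` on 2-CNFs with `b ≤ 2s`, `badInst`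
otherwise. [cite: BlaserIkenmeyerJindalLysikov2018, Lemma 11] [cite: BlaserIkenmeyerJindalLysikov2018, Thm. 3] -/
def reduceT (p : CNF ℕ × ℕ) : ℕ × ℕ × List ℤ × ℕ :=
  if IsWidthEq 2 p.1 ∧ p.2 ≤ 2 * p.1.length then instOf p.1 p.2 else badInst

/-! ### The entry list realises the reindexed §3 tensor -/

/-- Length of the entry list. [cite: BlaserIkenmeyerJindalLysikov2018, §1.4] -/
@[simp] theorem length_entries : (entries φ).length = (tOf φ + 1) * (nOf φ * nOf φ) := by
  simp [entries]

/-- Reading the entry list in row-major position. [cite: BlaserIkenmeyerJindalLysikov2018, §1.4] -/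
theorem getD_entries {h i j : ℕ} (hh : h ≤ tOf φ) (hi : i < nOf φ) (hj : j < nOf φ) :
    (entries φ).getD (h * (nOf φ * nOf φ) + i * nOf φ + j) 0 = entryInt φ h i j := by
  set n := nOf φ with hn
  have hn0 : 0 < n := by omega
  have hij : i * n + j < n * n := by nlinarith
  have hN : h * (n * n) + i * n + j < (tOf φ + 1) * (n * n) := by nlinarith
  rw [entries, List.getD_eq_getElem _ _ (by simpa using hN), List.getElem_map, List.getElem_range]
  have e1 : (h * (n * n) + i * n + j) / (n * n) = h := by
    rw [Nat.add_assoc, Nat.add_comm, Nat.add_mul_div_right _ _ (by positivity), Nat.div_eq_of_lt hij, zero_add]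
  have e2 : (h * (n * n) + i * n + j) / n % n = i := by
    rw [show h * (n * n) + i * n + j = j + (h * n + i) * n by ring, Nat.add_mul_div_right _ _ hn0,
      Nat.div_eq_of_lt hj, zero_add, Nat.add_comm, Nat.add_mul_mod_self_right, Nat.mod_eq_of_lt hi]
  have e3 : (h * (n * n) + i * n + j) % n = j := by
    rw [show h * (n * n) + i * n + j = j + (h * n + i) * n by ring, Nat.add_mul_mod_self_right, Nat.mod_eq_of_lt hj]
  rw [e1, e2, e3]

variable (K : Type u) [Field K]

/-- The row/column bijection `(clause, slot) ↦ 2·clause + slot`. [cite: BlaserIkenmeyerJindalLysikov2018, §3] -/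
def eqv : Fin (pairsFin φ).length × Fin 2 ≃ Fin (nOf φ) :=
  finProdFinEquiv.trans (finCongr (by rw [length_pairsFin, nOf]))

/-- The literal of the typed construction is the renamed literal occurrence. [cite: BlaserIkenmeyerJindalLysikov2018, §3] -/
theorem clauseLit_pairsFin (I : Fin (pairsFin φ).length) (A : Fin 2) :
    clauseLit (pairsFin φ) I A = litFin φ (litAt φ I.1 A.1) := by
  have hI : I.1 < φ.length := by simpa using I.2
  have hget : (pairsFin φ).get I = (litFin φ ((φ.getD I.1 []).getD 0 (0, false)),
      litFin φ ((φ.getD I.1 []).getD 1 (0, false))) := by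
    rw [List.get_eq_getElem]
    simp only [pairsFin, List.getElem_map, List.getD_eq_getElem _ _ hI]
  unfold clauseLit litAt
  rw [hget]
  fin_cases A <;> simp

/-- Components of `eqv⁻¹`. [cite: BlaserIkenmeyerJindalLysikov2018, §3] -/
theorem eqv_symm_apply_fst (i : Fin (nOf φ)) : (((eqv φ).symm i).1 : ℕ) = i.1 / 2 := by
  simp [eqv, finProdFinEquiv_symm_apply, Fin.coe_divNat]

/-- Components of `eqv⁻¹`. [cite: BlaserIkenmeyerJindalLysikov2018, §3] -/
theorem eqv_symm_apply_snd (i : Fin (nOf φ)) : (((eqv φ).symm i).2 : ℕ) = i.1 % 2 := by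
  simp [eqv, finProdFinEquiv_symm_apply, Fin.coe_modNat]

/-- **The constant slice read from the entry list is the reindexed `A₀` of §3.**
[cite: BlaserIkenmeyerJindalLysikov2018, §3 (construction before Obs. 10)] -/
theorem slice₀OfList_entries :
    slice₀OfList K (nOf φ) (entries φ) = (bijlA₀ K (pairsFin φ)).reindex (eqv φ) (eqv φ) := by
  ext i j
  have h := getD_entries φ (h := 0) (Nat.zero_le _) i.2 j.2
  rw [zero_mul, zero_add] at h
  rw [slice₀OfList, h, entryInt, if_pos rfl, Matrix.reindex_apply, Matrix.submatrix_apply, bijlA₀]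
  have h1 : ((eqv φ).symm i).1 = ((eqv φ).symm j).1 ↔ i.1 / 2 = j.1 / 2 := by
    rw [Fin.ext_iff, eqv_symm_apply_fst, eqv_symm_apply_fst]
  have h2 : ((eqv φ).symm i).2 = ((eqv φ).symm j).2 ↔ i.1 % 2 = j.1 % 2 := by
    rw [Fin.ext_iff, eqv_symm_apply_snd, eqv_symm_apply_snd]
  have h3 : ((eqv φ).symm i).2 = 0 ↔ i.1 % 2 = 0 := by
    rw [Fin.ext_iff, eqv_symm_apply_snd]; rfl
  simp only [a0Int, clauseLit_pairsFin, litFin, eqv_symm_apply_fst, eqv_symm_apply_snd, litConst]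
  by_cases c1 : i.1 / 2 = j.1 / 2
  · rw [if_pos c1, if_pos (h1.2 c1)]
    by_cases c2 : i.1 % 2 = j.1 % 2
    · rw [if_pos c2, if_pos (h2.2 c2)]
      split_ifs <;> simp
    · rw [if_neg c2, if_neg (fun h => c2 (h2.1 h))]
      by_cases c3 : i.1 % 2 = 0
      · rw [if_pos c3, if_pos (h3.2 c3)]; simp
      · rw [if_neg c3, if_neg (fun h => c3 (h3.1 h))]; simp
  · rw [if_neg c1, if_neg (fun h => c1 (h1.1 h))]; simp

/-- **The slices read from the entry list are the reindexed `A_k` of §3.**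
[cite: BlaserIkenmeyerJindalLysikov2018, §3 (construction before Obs. 10)] -/
theorem slicesOfList_entries :
    slicesOfList K (nOf φ) (tOf φ) (entries φ) = fun k => (bijlSlices K (pairsFin φ) k).reindex (eqv φ) (eqv φ) := by
  funext k
  ext i j
  have h := getD_entries φ (h := k.1 + 1) (by have := k.2; omega) i.2 j.2
  rw [slicesOfList, sq, h, entryInt, if_neg (Nat.succ_ne_zero _), Nat.add_sub_cancel, Matrix.reindex_apply,
    Matrix.submatrix_apply, bijlSlices]
  have h1 : (eqv φ).symm i = (eqv φ).symm j ↔ i = j := (eqv φ).symm.injective.eq_iff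
  simp only [sliceInt, clauseLit_pairsFin, litFin, eqv_symm_apply_fst, eqv_symm_apply_snd, litCoeff, rho,
    Fin.ext_iff]
  by_cases c1 : i = j
  · subst c1
    rw [if_pos rfl, if_pos rfl]
    split_ifs <;> simp
  · rw [if_neg (fun h => c1 (Fin.ext h)), if_neg (fun h => c1 (h1.1 h))]; simp

/-- The instance is well formed. [cite: BlaserIkenmeyerJindalLysikov2018, §1.4] -/
theorem wellFormedInst_instOf (b : ℕ) : WellFormedInst (instOf φ b) := by
  simp [WellFormedInst, instOf, sq]

/-- `badInst` is ill formed. [cite: BlaserIkenmeyerJindalLysikov2018, §1.4] -/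
theorem not_wellFormedInst_badInst : ¬ WellFormedInst badInst := by
  simp [WellFormedInst, badInst]

/-- Membership of a code in `crLanguage K`. [cite: BlaserIkenmeyerJindalLysikov2018, Lemma 11] -/
theorem mem_crLanguage_iff (x : ℕ × ℕ × List ℤ × ℕ) :
    tensorInstEncoding.encode x ∈ crLanguage K ↔
      WellFormedInst x ∧ completionRank (slice₀OfList K x.1 x.2.2.1) (slicesOfList K x.1 x.2.1 x.2.2.1) ≤ x.2.2.2 :=
  tensorInstEncoding.mem_toLanguage_iff _ x

/-- Membership of a code in `borderCRLanguage K`. [cite: BlaserIkenmeyerJindalLysikov2018, Thm. 3] -/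
theorem mem_borderCRLanguage_iff (x : ℕ × ℕ × List ℤ × ℕ) :
    tensorInstEncoding.encode x ∈ borderCRLanguage K ↔
      WellFormedInst x ∧
        borderCompletionRank (slice₀OfList K x.1 x.2.2.1) (slicesOfList K x.1 x.2.1 x.2.2.1) ≤ x.2.2.2 :=
  tensorInstEncoding.mem_toLanguage_iff _ x

/-- **Completion rank of the coded tensor is that of the §3 tensor of the renamed 2-CNF.**
[cite: BlaserIkenmeyerJindalLysikov2018, Lemma 11] -/
theorem completionRank_instOf :
    completionRank (slice₀OfList K (nOf φ) (entries φ)) (slicesOfList K (nOf φ) (tOf φ) (entries φ)) =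
      completionRank (bijlA₀ K (pairsFin φ)) (bijlSlices K (pairsFin φ)) := by
  rw [slice₀OfList_entries, slicesOfList_entries]
  exact completionRank_reindex (eqv φ) (Equiv.refl _) _ _

/-- **Border completion rank of the coded tensor is that of the §3 tensor of the renamed 2-CNF.**
[cite: BlaserIkenmeyerJindalLysikov2018, Thm. 3] -/
theorem borderCompletionRank_instOf :
    borderCompletionRank (slice₀OfList K (nOf φ) (entries φ)) (slicesOfList K (nOf φ) (tOf φ) (entries φ)) =
      borderCompletionRank (bijlA₀ K (pairsFin φ)) (bijlSlices K (pairsFin φ)) := by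
  rw [slice₀OfList_entries, slicesOfList_entries]
  exact borderCompletionRank_reindex (eqv φ) (Equiv.refl _) _ _

/-- In `ℕ` versus `ℤ`: `CR ≤ 2s − b` with `b ≤ 2s`. [cite: BlaserIkenmeyerJindalLysikov2018, Lemma 11] -/
theorem le_sub_iff_cast {R b s : ℕ} (hb : b ≤ 2 * s) : R ≤ 2 * s - b ↔ (R : ℤ) ≤ 2 * (s : ℤ) - b := by
  omega

/-- **Correctness for completion rank**: the code of `reduceT (φ, b)` is in `crLanguage K` iff
`(φ, b)` is a yes-instance of Max-2-SAT. [cite: BlaserIkenmeyerJindalLysikov2018, Lemma 11] -/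
theorem encode_reduceT_mem_crLanguage_iff (p : CNF ℕ × ℕ) :
    tensorInstEncoding.encode (reduceT p) ∈ crLanguage K ↔
      IsWidthEq 2 p.1 ∧ ∃ σ : ℕ → Bool, p.2 ≤ p.1.numSatClauses σ := by
  obtain ⟨φ, b⟩ := p
  rw [mem_crLanguage_iff]
  unfold reduceT
  by_cases hg : IsWidthEq 2 φ ∧ b ≤ 2 * φ.length
  · rw [if_pos hg]
    simp only [wellFormedInst_instOf, true_and]
    rw [show (instOf φ b).1 = nOf φ from rfl, show (instOf φ b).2.1 = tOf φ from rfl,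
      show (instOf φ b).2.2.1 = entries φ from rfl, show (instOf φ b).2.2.2 = 2 * φ.length - b from rfl,
      completionRank_instOf, le_sub_iff_cast hg.2, ← exists_numSat₂_pairsFin_iff φ hg.1]
    have hlen : (φ.length : ℤ) = ((pairsFin φ).length : ℤ) := by rw [length_pairsFin]
    rw [hlen, BIJL2018_lemma11_holds (K := K) (tOf φ) (pairsFin φ) b]
    exact ⟨fun h => ⟨hg.1, h⟩, fun h => h.2⟩
  · rw [if_neg hg]
    simp only [not_wellFormedInst_badInst, false_and, false_iff, not_and]
    intro h2 ⟨σ, hσ⟩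
    exact hg ⟨h2, hσ.trans ((numSatClauses_le_length φ σ).trans (by omega))⟩

/-- **Correctness for border completion rank**: the code of `reduceT (φ, b)` is in
`borderCRLanguage K` iff `(φ, b)` is a yes-instance of Max-2-SAT. [cite: BlaserIkenmeyerJindalLysikov2018, Thm. 3 (proof: Lemma 14)] -/
theorem encode_reduceT_mem_borderCRLanguage_iff (p : CNF ℕ × ℕ) :
    tensorInstEncoding.encode (reduceT p) ∈ borderCRLanguage K ↔
      IsWidthEq 2 p.1 ∧ ∃ σ : ℕ → Bool, p.2 ≤ p.1.numSatClauses σ := by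
  obtain ⟨φ, b⟩ := p
  rw [mem_borderCRLanguage_iff]
  unfold reduceT
  by_cases hg : IsWidthEq 2 φ ∧ b ≤ 2 * φ.length
  · rw [if_pos hg]
    simp only [wellFormedInst_instOf, true_and]
    rw [show (instOf φ b).1 = nOf φ from rfl, show (instOf φ b).2.1 = tOf φ from rfl,
      show (instOf φ b).2.2.1 = entries φ from rfl, show (instOf φ b).2.2.2 = 2 * φ.length - b from rfl,
      borderCompletionRank_instOf, le_sub_iff_cast hg.2, ← exists_numSat₂_pairsFin_iff φ hg.1]
    have hlen : (φ.length : ℤ) = ((pairsFin φ).length : ℤ) := by rw [length_pairsFin]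
    rw [hlen, BIJL2018_lemma14_holds (K := K) (tOf φ) (pairsFin φ) b]
    exact ⟨fun h => ⟨hg.1, h⟩, fun h => h.2⟩
  · rw [if_neg hg]
    simp only [not_wellFormedInst_badInst, false_and, false_iff, not_and]
    intro h2 ⟨σ, hσ⟩
    exact hg ⟨h2, hσ.trans ((numSatClauses_le_length φ σ).trans (by omega))⟩

/-! ### The machine: `reduceT` on codes, in the typed `CodeFP` algebra -/

open CodeFP

/-- The code of an instance `(n, m, entries, r)`: `tensorInstEncoding`, i.e. three nested pairs of
binary numerals around a headed list of sign–magnitude integers. [cite: BlaserIkenmeyerJindalLysikov2018, §1.4] -/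
def instE : ℕ × ℕ × List ℤ × ℕ → List Bool := pairE natE (pairE natE (pairE (listE smE) natE))

/-- `instE` is `tensorInstEncoding.encode`. [cite: AroraBarak2009, §0.1 (codes of pairs and lists)] -/
theorem instE_eq : (tensorInstEncoding.encode : ℕ × ℕ × List ℤ × ℕ → List Bool) = instE := by
  unfold instE tensorInstEncoding smE
  rw [pairE_eq, pairE_eq, pairE_eq, listE_eq, natE_eq]

/-- Literal occurrence `(i, a)` on codes. [cite: AroraBarak2009, §1.3] -/
theorem litAtFP : CodeFP (pairE cnfE (pairE natE natE)) litE (fun p => litAt p.1 p.2.1 p.2.2) := by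
  have hcl : CodeFP (pairE cnfE (pairE natE natE)) (rawE litE) (fun p => p.1.getD p.2.1 []) :=
    ((rawGetD (rawE litE) (rawE_nil litE)).comp ((clausesFP.comp (fst _ _)).pair (snd _ _).fst')).congr
      fun _ => rfl
  exact ((rawGetOr litE).comp (hcl.pair ((snd _ _).snd'.pair (const _ (((0 : ℕ), false) : Literal ℕ))))).congr
    fun _ => rfl

/-- The list of variable occurrences on codes. [cite: AroraBarak2009, §1.3] -/
theorem vlistFP : CodeFP cnfE (rawE natE) vlist :=
  ((map₀ (fst natE bitE)).comp ((flatten litE).comp clausesFP)).congr fun _ => rfl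

/-- The renaming `rhoN` on codes (`idxOf` is a `findIdx`). [cite: AroraBarak2009, §1.3] -/
theorem rhoNFP : CodeFP (pairE cnfE natE) natE (fun p => rhoN p.1 p.2) := by
  have hidx : CodeFP (pairE natE (rawE natE)) natE (fun q => q.2.idxOf q.1) :=
    (findIdxFP (σ := ℕ) (α := ℕ) (p := fun q => q.2 == q.1)
      ((beq natE_injective).comp ((snd _ _).pair (fst _ _)))).congr fun _ => rfl
  have h1 : CodeFP (pairE cnfE natE) natE (fun p => (vlist p.1).idxOf p.2) :=
    (hidx.comp ((snd _ _).pair (vlistFP.comp (fst _ _)))).congr fun _ => rfl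
  exact (natMin.comp (h1.pair (natMul.comp ((const _ 2).pair (lengthFP.comp (fst _ _)))))).congr fun _ => rfl

/-- The context of an entry: `(φ, h, i, j)`. [cite: AroraBarak2009, §1.3] -/
abbrev ctxE : CNF ℕ × ℕ × ℕ × ℕ → List Bool := pairE cnfE (pairE natE (pairE natE natE))

/-- **The entry table on codes.** [cite: BlaserIkenmeyerJindalLysikov2018, §3] [cite: AroraBarak2009, §1.3] -/
theorem entryIntFP : CodeFP ctxE intE (fun t => entryInt t.1 t.2.1 t.2.2.1 t.2.2.2) := by
  have hφ : CodeFP ctxE cnfE (fun t => t.1) := fst _ _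
  have hh : CodeFP ctxE natE (fun t => t.2.1) := (snd _ _).fst'
  have hi : CodeFP ctxE natE (fun t => t.2.2.1) := (snd _ _).snd'.fst'
  have hj : CodeFP ctxE natE (fun t => t.2.2.2) := (snd _ _).snd'.snd'
  have hi2 : CodeFP ctxE natE (fun t => t.2.2.1 / 2) := (natDiv.comp (hi.pair (const _ 2))).congr fun _ => rfl
  have hj2 : CodeFP ctxE natE (fun t => t.2.2.2 / 2) := (natDiv.comp (hj.pair (const _ 2))).congr fun _ => rfl
  have him : CodeFP ctxE natE (fun t => t.2.2.1 % 2) := (natMod.comp (hi.pair (const _ 2))).congr fun _ => rfl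
  have hjm : CodeFP ctxE natE (fun t => t.2.2.2 % 2) := (natMod.comp (hj.pair (const _ 2))).congr fun _ => rfl
  have hlit : CodeFP ctxE litE (fun t => litAt t.1 (t.2.2.1 / 2) (t.2.2.1 % 2)) :=
    (litAtFP.comp (hφ.pair (hi2.pair him))).congr fun _ => rfl
  have hpol : CodeFP ctxE bitE (fun t => (litAt t.1 (t.2.2.1 / 2) (t.2.2.1 % 2)).2) := hlit.snd'
  have hrho : CodeFP ctxE natE (fun t => rhoN t.1 (litAt t.1 (t.2.2.1 / 2) (t.2.2.1 % 2)).1) :=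
    (rhoNFP.comp (hφ.pair hlit.fst')).congr fun _ => rfl
  -- the constant slice
  have ha0 : CodeFP ctxE intE (fun t => a0Int t.1 t.2.2.1 t.2.2.2) := by
    refine (((natEq.comp (hi2.pair hj2))).ite
      (((natEq.comp (him.pair hjm))).ite (hpol.ite (const _ (1 : ℤ)) (const _ (0 : ℤ)))
        (((natEq.comp (him.pair (const _ 0)))).ite (const _ (1 : ℤ)) (const _ (0 : ℤ))))
      (const _ (0 : ℤ))).congr fun t => ?_
    unfold a0Int
    simp only [decide_eq_true_eq]
  -- the slices
  have hsl : CodeFP ctxE intE (fun t => sliceInt t.1 (t.2.1 - 1) t.2.2.1 t.2.2.2) := by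
    have hk : CodeFP ctxE natE (fun t => t.2.1 - 1) := (natSub.comp (hh.pair (const _ 1))).congr fun _ => rfl
    refine (((natEq.comp (hi.pair hj))).ite
      (((natEq.comp (hrho.pair hk))).ite (hpol.ite (const _ (-1 : ℤ)) (const _ (1 : ℤ))) (const _ (0 : ℤ)))
      (const _ (0 : ℤ))).congr fun t => ?_
    unfold sliceInt
    simp only [decide_eq_true_eq]
  refine (((natEq.comp (hh.pair (const _ 0)))).ite ha0 hsl).congr fun t => ?_
  unfold entryInt
  simp only [decide_eq_true_eq]

/-- A unary budget `1^{(2s+2)³}` bounding the number of entries. [cite: AroraBarak2009, §1.3 (loops over polynomial bounds)] -/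
theorem budgetFP : CodeFP cnfE (rawE unitE) (fun φ : CNF ℕ => List.replicate ((2 * φ.length + 2) ^ 3) ()) := by
  have hu : CodeFP cnfE unE (fun φ : CNF ℕ => φ.length) :=
    ((ulength (listE litE)).comp (rawOfList (listE litE))).congr fun _ => rfl
  have h2 : CodeFP cnfE unE (fun φ : CNF ℕ => 2 * φ.length + 2) :=
    (unSucc.comp (unSucc.comp (unAdd.comp (hu.pair hu)))).congr fun φ => by simp only; ring
  exact ((unitsPow 3).comp h2).congr fun _ => rfl

/-- The number of entries is within the budget. [cite: AroraBarak2009, §1.3] -/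
theorem numEntries_le (φ : CNF ℕ) : (tOf φ + 1) * (nOf φ * nOf φ) ≤ (2 * φ.length + 2) ^ 3 := by
  unfold tOf nOf
  have : φ.length * 2 ≤ 2 * φ.length + 2 := by omega
  calc (2 * φ.length + 1 + 1) * (φ.length * 2 * (φ.length * 2))
      ≤ (2 * φ.length + 2) * ((2 * φ.length + 2) * (2 * φ.length + 2)) :=
        Nat.mul_le_mul (by omega) (Nat.mul_le_mul this this)
    _ = (2 * φ.length + 2) ^ 3 := by ring

/-- **The entry list on codes** (a bounded range, decoded by `div`/`mod`, mapped through the entry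
table). [cite: BlaserIkenmeyerJindalLysikov2018, §1.4] [cite: AroraBarak2009, §1.3] -/
theorem entriesFP : CodeFP cnfE (rawE intE) entries := by
  have hn : CodeFP cnfE natE nOf := (natMul.comp (lengthFP.pair (const _ 2))).congr fun _ => rfl
  have ht1 : CodeFP cnfE natE (fun φ => tOf φ + 1) :=
    (natAdd.comp ((natAdd.comp ((natMul.comp ((const _ 2).pair lengthFP)).pair (const _ 1))).pair (const _ 1))).congr
      fun _ => rfl
  have hM : CodeFP cnfE natE (fun φ => (tOf φ + 1) * (nOf φ * nOf φ)) :=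
    (natMul.comp (ht1.pair (natMul.comp (hn.pair hn)))).congr fun _ => rfl
  have hrange : CodeFP cnfE (rawE natE) (fun φ => List.range ((tOf φ + 1) * (nOf φ * nOf φ))) :=
    ((brange unitE).comp (budgetFP.pair hM)).congr fun φ => by
      simp only [List.length_replicate, min_eq_left (numEntries_le φ)]
  -- the item map, context `φ`, item `N`
  have hN : CodeFP (pairE cnfE natE) natE (fun q => q.2) := snd _ _
  have hn' : CodeFP (pairE cnfE natE) natE (fun q => nOf q.1) := hn.comp (fst _ _)
  have hitem : CodeFP (pairE cnfE natE) intE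
      (fun q => entryInt q.1 (q.2 / (nOf q.1 * nOf q.1)) (q.2 / nOf q.1 % nOf q.1) (q.2 % nOf q.1)) :=
    (entryIntFP.comp ((fst _ _).pair ((natDiv.comp (hN.pair (natMul.comp (hn'.pair hn')))).pair
      ((natMod.comp ((natDiv.comp (hN.pair hn')).pair hn')).pair (natMod.comp (hN.pair hn')))))).congr fun _ => rfl
  exact ((map hitem).comp ((CodeFP.id cnfE).pair hrange)).congr fun _ => rfl

/-- **The instance `(n, t, entries, 2s − b)` on codes.** [cite: BlaserIkenmeyerJindalLysikov2018, Lemma 11] [cite: AroraBarak2009, §1.3] -/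
theorem instOfFP : CodeFP (pairE cnfE natE) instE (fun p => instOf p.1 p.2) := by
  have hlen : CodeFP (pairE cnfE natE) natE (fun p => p.1.length) := lengthFP.comp (fst _ _)
  have hn : CodeFP (pairE cnfE natE) natE (fun p => nOf p.1) := (natMul.comp (hlen.pair (const _ 2))).congr fun _ => rfl
  have ht : CodeFP (pairE cnfE natE) natE (fun p => tOf p.1) :=
    (natAdd.comp ((natMul.comp ((const _ 2).pair hlen)).pair (const _ 1))).congr fun _ => rfl
  have he : CodeFP (pairE cnfE natE) (listE smE) (fun p => entries p.1) :=
    ((listOfRaw smE).comp ((map₀ smOfInt).comp (entriesFP.comp (fst _ _)))).congr fun _ => by simp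
  have hr : CodeFP (pairE cnfE natE) natE (fun p => 2 * p.1.length - p.2) :=
    (natSub.comp ((natMul.comp ((const _ 2).pair hlen)).pair (snd _ _))).congr fun _ => rfl
  exact (hn.pair (ht.pair (he.pair hr))).congr fun _ => rfl

/-- **The guard** "2-CNF and `b ≤ 2s`" on codes. [cite: AroraBarak2009, §1.3] -/
theorem guardFP : CodeFP (pairE cnfE natE) bitE (fun p => decide (IsWidthEq 2 p.1 ∧ p.2 ≤ 2 * p.1.length)) := by
  have hw : CodeFP (pairE unitE (rawE litE)) bitE (fun q => decide (q.2.length = 2)) :=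
    (natEq.comp (((natLength litE).comp (snd _ _)).pair (const _ 2))).congr fun _ => rfl
  have hall : CodeFP (pairE cnfE natE) bitE (fun p => p.1.all fun c => decide (c.length = 2)) :=
    ((all hw).comp ((const _ ()).pair (clausesFP.comp (fst _ _)))).congr fun _ => rfl
  have hb : CodeFP (pairE cnfE natE) bitE (fun p => decide (p.2 ≤ 2 * p.1.length)) :=
    (natLe.comp ((snd _ _).pair (natMul.comp ((const _ 2).pair (lengthFP.comp (fst _ _)))))).congr fun _ => rfl
  refine (hall.and hb).congr fun p => ?_
  rw [Bool.eq_iff_iff, Bool.and_eq_true, List.all_eq_true, decide_eq_true_iff, decide_eq_true_iff]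
  simp only [decide_eq_true_iff]
  rfl

/-- **The instance map `reduceT` is computed on codes by a polynomial-time string function.**
[cite: BlaserIkenmeyerJindalLysikov2018, Thm. 3] [cite: AroraBarak2009, §1.3] -/
theorem reduceTFP : CodeFP (pairE cnfE natE) instE reduceT := by
  refine (guardFP.ite instOfFP (const _ badInst)).congr fun p => ?_
  unfold reduceT
  simp only [decide_eq_true_eq]

/-! ### The guard on strings: canonical codes of `(φ, b)` -/

/-- The total decoder of instance codes. [cite: AroraBarak2009, §0.1] -/
def decInst (w : List Bool) : CNF ℕ × ℕ := (NegCNF.decCNF (boolUnpair w).1, decodeNat (boolUnpair w).2)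

/-- The canonical re-encoding of instance codes. [cite: AroraBarak2009, §0.1] -/
def canonInstFn : List Bool → List Bool := CanonCode.canonPairFn KSATRed.canonCNFFn Brick.canonF

/-- The decoder is total with value `decInst`, and `canonInstFn` re-encodes. [cite: AroraBarak2009, §0.1] -/
theorem canonInstFn_spec (w : List Bool) :
    encodingCNFNat.decode w = some (decInst w) ∧ canonInstFn w = encodingCNFNat.encode (decInst w) :=
  CanonCode.canonPairFn_eq encodingCNF encodingNatBool NegCNF.decCNF decodeNat NegCNF.decode_cnf
    (fun _ => rfl) KSATRed.canonCNFFn_eq Brick.canonF_eq_encodeNat_decodeNat w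

/-- `canonInstFn ∈ FP`. [cite: AroraBarak2009, §1.3] -/
theorem canonInstFn_mem_FP : canonInstFn ∈ FP :=
  CanonCode.canonPairFn_mem_FP KSATRed.canonCNFFn_mem_FP Brick.canonF_mem_FP

/-- A member of a language of instance codes is a code: it re-encodes to itself. [cite: AroraBarak2009, §0.1] -/
theorem encode_decInst_of_mem {S : Set (CNF ℕ × ℕ)} {x : List Bool} (h : x ∈ encodingCNFNat.toLanguage S) :
    encodingCNFNat.encode (decInst x) = x := by
  obtain ⟨p, -, rfl⟩ := h
  have h1 := (canonInstFn_spec (encodingCNFNat.encode p)).1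
  rw [encodingCNFNat.decode_encode] at h1
  rw [← Option.some.inj h1]

/-- **The code test** `isCanonInstFn w = [encode (decInst w) = w]`. [cite: AroraBarak2009, §1.3] -/
def isCanonInstFn : List Bool → List Bool := eqPairFn ∘ fanoutFn canonInstFn id

/-- `isCanonInstFn ∈ FP`. [cite: AroraBarak2009, §1.3] -/
theorem isCanonInstFn_mem_FP : isCanonInstFn ∈ FP :=
  comp_mem_FP eqPairFn_mem_FP (fanoutFn_mem_FP canonInstFn_mem_FP OracleCompose.id_mem_FP)

/-- Value of the code test. [cite: AroraBarak2009, §1.3] -/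
theorem isCanonInstFn_apply (w : List Bool) :
    isCanonInstFn w = [decide (encodingCNFNat.encode (decInst w) = w)] := by
  rw [isCanonInstFn, Function.comp_apply, fanoutFn_apply, eqPairFn_boolPair, (canonInstFn_spec w).2]
  rfl

/-- The fixed non-member (an ill-formed instance code). [cite: BlaserIkenmeyerJindalLysikov2018, §1.4] -/
def badCodeT : List Bool := tensorInstEncoding.encode badInst

/-- `badCodeT ∉ crLanguage K`. [cite: BlaserIkenmeyerJindalLysikov2018, §1.4] -/
theorem badCodeT_not_mem_crLanguage : badCodeT ∉ crLanguage K := fun h =>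
  not_wellFormedInst_badInst ((mem_crLanguage_iff K badInst).1 h).1

/-- `badCodeT ∉ borderCRLanguage K`. [cite: BlaserIkenmeyerJindalLysikov2018, §1.4] -/
theorem badCodeT_not_mem_borderCRLanguage : badCodeT ∉ borderCRLanguage K := fun h =>
  not_wellFormedInst_badInst ((mem_borderCRLanguage_iff K badInst).1 h).1

/-- Membership of a code in `MAX2SAT` (pair form). [cite: GareyJohnsonStockmeyer1976, Thm. 1.1] -/
theorem mem_MAX2SAT_iff' (p : CNF ℕ × ℕ) :
    encodingCNFNat.encode p ∈ MAX2SAT ↔ IsWidthEq 2 p.1 ∧ ∃ σ : ℕ → Bool, p.2 ≤ p.1.numSatClauses σ :=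
  encodingCNFNat.mem_toLanguage_iff _ p

/-! ### `MAX2SAT ≤ₚ CR`, `MAX2SAT ≤ₚ border-CR`, and the two discharges -/

/-- **Max-2-SAT reduces to `CR ≤ r`** (the §3 tensor, Lemma 11). [cite: BlaserIkenmeyerJindalLysikov2018, Lemma 11] -/
theorem MAX2SAT_karpReducible_crLanguage : MAX2SAT ≤ₚ crLanguage K := by
  obtain ⟨f, hf, hfr⟩ := reduceTFP
  refine ⟨iteFn isCanonInstFn f (fun _ => badCodeT),
    iteFn_mem_FP isCanonInstFn_mem_FP hf (const_mem_FP _), fun x => ?_⟩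
  show x ∈ MAX2SAT ↔ iteFn isCanonInstFn f (fun _ => badCodeT) x ∈ crLanguage K
  by_cases hx : encodingCNFNat.encode (decInst x) = x
  · have hc : isCanonInstFn x = [true] := by rw [isCanonInstFn_apply]; simp [hx]
    rw [iteFn_apply_true hc, ← hx, mem_MAX2SAT_iff', encodingCNFNat_eq, hfr, ← instE_eq,
      encode_reduceT_mem_crLanguage_iff]
  · have hc : isCanonInstFn x = [false] := by rw [isCanonInstFn_apply]; simp [hx]
    rw [iteFn_apply_false hc]
    exact ⟨fun h => (hx (encode_decInst_of_mem h)).elim, fun h => (badCodeT_not_mem_crLanguage K h).elim⟩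

/-- **Max-2-SAT reduces to `\underline{CR} ≤ r`** (the same map, Lemma 14). [cite: BlaserIkenmeyerJindalLysikov2018, Thm. 3 (proof)] -/
theorem MAX2SAT_karpReducible_borderCRLanguage : MAX2SAT ≤ₚ borderCRLanguage K := by
  obtain ⟨f, hf, hfr⟩ := reduceTFP
  refine ⟨iteFn isCanonInstFn f (fun _ => badCodeT),
    iteFn_mem_FP isCanonInstFn_mem_FP hf (const_mem_FP _), fun x => ?_⟩
  show x ∈ MAX2SAT ↔ iteFn isCanonInstFn f (fun _ => badCodeT) x ∈ borderCRLanguage K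
  by_cases hx : encodingCNFNat.encode (decInst x) = x
  · have hc : isCanonInstFn x = [true] := by rw [isCanonInstFn_apply]; simp [hx]
    rw [iteFn_apply_true hc, ← hx, mem_MAX2SAT_iff', encodingCNFNat_eq, hfr, ← instE_eq,
      encode_reduceT_mem_borderCRLanguage_iff]
  · have hc : isCanonInstFn x = [false] := by rw [isCanonInstFn_apply]; simp [hx]
    rw [iteFn_apply_false hc]
    exact ⟨fun h => (hx (encode_decInst_of_mem h)).elim, fun h => (badCodeT_not_mem_borderCRLanguage K h).elim⟩

end BIJL18NPHard

section Discharges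

variable {K : Type u} [Field K]

/-- **Discharge of `BIJL2018_lemma11_npHard`** (BIJL Lemma 11, second sentence: "Thus the problem
`CR(A₀, A₁, …, A_t) ≤? k` is NP-hard"): Max-2-SAT is NP-hard (`MAX2SAT_isNPHard`,
Garey–Johnson–Stockmeyer 1976) and reduces to `crLanguage K` by the §3 tensor (Lemma 11,
`BIJL2018_lemma11_holds`), hardness propagating along `≤ₚ` (`IsHard.of_reducible_holds`); every
field `K`. [cite: BlaserIkenmeyerJindalLysikov2018, Lemma 11] -/
theorem BIJL2018_lemma11_npHard_holds : BIJL2018_lemma11_npHard K :=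
  IsHard.of_reducible_holds MAX2SAT_isNPHard (BIJL18NPHard.MAX2SAT_karpReducible_crLanguage K)

/-- **Discharge of `BIJL2018_thm3`** (BIJL Thm. 3: "Given a tensor `t` over `K` and an integer `r`,
deciding whether the border completion rank `\underline{CR}(t) ≤ r` is NP-hard"; printed proof,
ECCC p. 10: Lemma 14 and the NP-hardness of Max-2-SAT): `MAX2SAT_isNPHard`, the same Karp map, and
Lemma 14 (`BIJL2018_lemma14_holds`); every field `K`. [cite: BlaserIkenmeyerJindalLysikov2018, Thm. 3] -/
theorem BIJL2018_thm3_holds : BIJL2018_thm3 K :=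
  IsHard.of_reducible_holds MAX2SAT_isNPHard (BIJL18NPHard.MAX2SAT_karpReducible_borderCRLanguage K)

end Discharges

end Literature.Barriers.ValiantsHypothesis
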